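import Summits.BirchSwinnertonDyer.Rank1Residual.P2.CornerFTwoCertificatesKrizLiBases
import Summits.BirchSwinnertonDyer.Rank1Residual.P2.KrizLiTwistMinimalModelsGoodBases
import Summits.BirchSwinnertonDyer.Rank1Residual.P2.KrizLiTwistMinimalModelsAdditiveBases
import Literature.NumberTheory.EllipticCurves.Rank1Residual.CornerFTwoCertificates.RecordsKrizLiBases
import HarnessLib

/-!
# Cell `bsd-print-cf2` (D-0131 (2) PRINT TIER, leaf CornerF @ `p = 2`), seat ty3 — the Kriz–Li certificate
# records at the seven (★)-CERTIFIED `j = 0` bases, THE RECORD'S CURVE ON THE NOSE: for every certified record,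
# its listed model (`y² + y = x³ + k` resp. `y² = x³ + a₆`) is a globally minimal elliptic curve with
# `ord_{s=1} L = 1 ∧ BSD(·, 2)` BY NAME

HONEST FRAMING (cell `bsd-print-cf2`, run/shared/lean/pub/bsd-print-cf2/; verbatim): PARTITION currency
only — the leaf counts when its class theorem is in the kernel BY NAME; every imported theorem carries its
printed hypotheses verbatim. The leaf is OPEN AS A CLASS; nothing class-wide is closed here; theorems
only, no definition, no named fact. Companion of `P2/CornerFTwoCertificatesKrizLiBasesDisplay.lean` (ty3 g2:
`BSD(W′, 2)` for every globally minimal `W′` in the ISOGENY CLASS of a certified member `E^{(d)}` / partner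
`E^{(d·d_K)}`), sharpened with ty2 g5's twist models (`P2/KrizLiTwistMinimalModels{GoodBases,AdditiveBases}.lean`,
landed after the g2 display was written): the certificate schema `KrizLiSchema.lean` rechecks the a-invariants
of a record only as "five integers" at bases other than `243a1`, so §1 first certifies PER LIST, in the kernel
(`decide`), that every record of `RecordsKrizLiBases.lean` lists EXACTLY the twist model — `[0, 0, 1, 0, k]` with
`4k + 1 = t·d³` at the cubic bases (`t = 7⁴, −7, 13⁵` for `1323a1, 1323m1, 4563a1`), `[0, 0, 0, 0, a₆]` with
`a₆ = B·d³` at the Mordell bases (`B = 36, 48, 2, −2` for `972d1, 3888s1, 1728a1, 1728v1`) —; §2 decodes a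
certified record into ty2's membership `d ∈ 𝒩(E, ℚ(√d_K))` (as in the g2 glue, now exposed as lemmas
`inN_curveX_of_check`); §3 concludes, record by record: the LISTED CURVE is globally minimal (elliptic) with
`ord_{s=1} L = 1 ∧ BSD(·, 2)`, granted p3's seven binders `hKL h33 hS31 hBF hmod hGZK hCassels` (Kriz–Li Thm 5.1 (2)
/ Thm 4.3, Creutz–Miller + Miller–Stoll, Burungale–Flach, modularity, GZK, Cassels) and the DISPLAYED
(★)-certificate `hSD : HasKrizLiStarDatum E (ℚ(√d_K))` (kernel-rechecked certificate records
`RecordsStarJZero{Good,Bad}.lean`; currency LITERAL-by-name((★)-certificate)). In the cell's partition: finite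
certified samples of the generic Kriz–Li (★)-door, aside 21366, now model-exact. beyond-print theorem: NO.
[cite: KrizLi2019, Thm. 1.12 (FMS Thm. 5.1 (2)), Thm. 4.3, Def. 4.1 and §6 Ex. 6.2]

References: [KrizLi2019] Thm 1.12 (FMS 5.1), Thm 4.3, Def 4.1; [CreutzMiller2012] Thm 1.1; [BurungaleFlach2024]
Cor 2; [MilneADT2006] Thm I.7.3; [SilvermanAEC2009] VII.1 Rem. 1.1, X.5 Prop. 5.4; [Kraus1989] Prop. 2;
[Miller2011LMS] Def 1.1; [Cremona1997] Table 1.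
-/

noncomputable section

open scoped Classical

open WeierstrassCurve NumberField Literature.NumberTheory.EllipticCurves
  Literature.NumberTheory.EllipticCurves.Rank1Residual
  Literature.NumberTheory.EllipticCurves.ModularForms
  Literature.NumberTheory.EllipticCurves.Rank1Residual.CornerFTwoCertificates
  Summit.BirchSwinnertonDyer.Rank1Residual

set_option autoImplicit false

namespace Summit.BirchSwinnertonDyer.Rank1Residual.P2

/-! ## §1 Per list, IN THE KERNEL: every record lists exactly the twist model of its base -/

/-- At `1323a1` every record's `ainvs` is `[0, 0, 1, 0, k]` with `4k + 1 = 2401·d³` (`decide`).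
[cite: SilvermanAEC2009, X.5 Prop. 5.4] [cite: Cremona1997, Table 1 (1323a1)] -/
theorem twistModel_of_mem_recordsKrizLiThirteenTwentyThreeA : ∀ r ∈ recordsKrizLiThirteenTwentyThreeA,
    r.ainvs = [0, 0, 1, 0, r.ainvs.getLastD 0] ∧ 4 * r.ainvs.getLastD 0 + 1 = (r.d : ℤ) ^ 3 * 2401 := by
  decide

/-- At `1323m1` every record's `ainvs` is `[0, 0, 1, 0, k]` with `4k + 1 = -7·d³` (`decide`).
[cite: SilvermanAEC2009, X.5 Prop. 5.4] [cite: Cremona1997, Table 1 (1323m1)] -/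
theorem twistModel_of_mem_recordsKrizLiThirteenTwentyThreeM : ∀ r ∈ recordsKrizLiThirteenTwentyThreeM,
    r.ainvs = [0, 0, 1, 0, r.ainvs.getLastD 0] ∧ 4 * r.ainvs.getLastD 0 + 1 = (r.d : ℤ) ^ 3 * (-7) := by
  decide

/-- At `4563a1` every record's `ainvs` is `[0, 0, 1, 0, k]` with `4k + 1 = 371293·d³` (`decide`).
[cite: SilvermanAEC2009, X.5 Prop. 5.4] [cite: Cremona1997, Table 1 (4563a1)] -/
theorem twistModel_of_mem_recordsKrizLiFortyFiveSixtyThreeA : ∀ r ∈ recordsKrizLiFortyFiveSixtyThreeA,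
    r.ainvs = [0, 0, 1, 0, r.ainvs.getLastD 0] ∧ 4 * r.ainvs.getLastD 0 + 1 = (r.d : ℤ) ^ 3 * 371293 := by
  decide

/-- At `972d1` every record's `ainvs` is `[0, 0, 0, 0, a₆]` with `a₆ = 36·d³` (`decide`).
[cite: SilvermanAEC2009, X.5 Prop. 5.4] [cite: Cremona1997, Table 1 (972d1)] -/
theorem twistModel_of_mem_recordsKrizLiNineSeventyTwoD : ∀ r ∈ recordsKrizLiNineSeventyTwoD,
    r.ainvs = [0, 0, 0, 0, r.ainvs.getLastD 0] ∧ r.ainvs.getLastD 0 = (r.d : ℤ) ^ 3 * 36 := by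
  decide

/-- At `3888s1` every record's `ainvs` is `[0, 0, 0, 0, a₆]` with `a₆ = 48·d³` (`decide`).
[cite: SilvermanAEC2009, X.5 Prop. 5.4] [cite: Cremona1997, Table 1 (3888s1)] -/
theorem twistModel_of_mem_recordsKrizLiThirtyEightEightyEightS : ∀ r ∈ recordsKrizLiThirtyEightEightyEightS,
    r.ainvs = [0, 0, 0, 0, r.ainvs.getLastD 0] ∧ r.ainvs.getLastD 0 = (r.d : ℤ) ^ 3 * 48 := by
  decide

/-- At `1728a1` every record's `ainvs` is `[0, 0, 0, 0, a₆]` with `a₆ = 2·d³` (`decide`).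
[cite: SilvermanAEC2009, X.5 Prop. 5.4] [cite: Cremona1997, Table 1 (1728a1)] -/
theorem twistModel_of_mem_recordsKrizLiSeventeenTwentyEightA : ∀ r ∈ recordsKrizLiSeventeenTwentyEightA,
    r.ainvs = [0, 0, 0, 0, r.ainvs.getLastD 0] ∧ r.ainvs.getLastD 0 = (r.d : ℤ) ^ 3 * 2 := by
  decide

/-- At `1728v1` every record's `ainvs` is `[0, 0, 0, 0, a₆]` with `a₆ = -2·d³` (`decide`).
[cite: SilvermanAEC2009, X.5 Prop. 5.4] [cite: Cremona1997, Table 1 (1728v1)] -/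
theorem twistModel_of_mem_recordsKrizLiSeventeenTwentyEightV : ∀ r ∈ recordsKrizLiSeventeenTwentyEightV,
    r.ainvs = [0, 0, 0, 0, r.ainvs.getLastD 0] ∧ r.ainvs.getLastD 0 = (r.d : ℤ) ^ 3 * (-2) := by
  decide

/-! ## §2 A certified record at base data `(d_K, c, badPrimes)` decoded to ty2's membership `d ∈ 𝒩(E, ℚ(√d_K))` -/

/-- A certified `1323a1` record (base data `(-47, -38416, [2, 3, 7])`) decoded: `d ∈ 𝒩(1323a1, ℚ(√-47))`,
`0 < d`, `d ≡ 1 (mod 12)`, `7 ∤ d`. [cite: KrizLi2019, Def. 4.1 (FMS) = arXiv Def. 3.1] -/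
theorem inN_curve1323a1_of_check {r : KLRecord} (h : r.check = true) (hD : r.fieldDisc = -47)
    (hc : r.cubeConst = -38416) (hb : r.badPrimes = [2, 3, 7]) :
    KrizLi2019.InN curve1323a1 (sqrtField (-47)) (r.d : ℤ) ∧ (0 : ℤ) < (r.d : ℤ) ∧ (r.d : ℤ) % 12 = 1 ∧ ¬ (7 : ℤ) ∣ (r.d : ℤ) := by
  obtain ⟨hd0, hd12, hd4, hsq, hP⟩ := klExplicit_of_check h hD hc hb (by simp)
  obtain ⟨-, hdK⟩ := isImaginaryQuadratic_and_discr_sqrtField_neg_fortySeven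
  refine ⟨inN_curve1323a1_of_explicit (sqrtField.finrank_eq_two (-47)) hd4 hsq fun ℓ hℓ hℓd => ?_, hd0, hd12,
    fun h7 => (hP 7 (by norm_num) (Int.natCast_dvd.mp (by exact_mod_cast h7))).1 (by simp)⟩
  obtain ⟨hbad, -, hj, hev⟩ := hP ℓ hℓ hℓd
  refine ⟨fun e => hbad (by simp [e]), fun e => hbad (by simp [e]), fun e => hbad (by simp [e]),
      by rw [hdK]; exact hj, ?_⟩
  have e : ((-38416 : ℤ) : ZMod ℓ) = -(16 * (4 * (600 : ZMod ℓ) + 1)) := by push_cast; norm_num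
  rw [← e]; exact hev

/-- A certified `1323m1` record (base data `(-47, 112, [2, 3, 7])`) decoded: `d ∈ 𝒩(1323m1, ℚ(√-47))`,
`0 < d`, `d ≡ 1 (mod 12)`, `7 ∤ d`. [cite: KrizLi2019, Def. 4.1 (FMS) = arXiv Def. 3.1] -/
theorem inN_curve1323m1_of_check {r : KLRecord} (h : r.check = true) (hD : r.fieldDisc = -47)
    (hc : r.cubeConst = 112) (hb : r.badPrimes = [2, 3, 7]) :
    KrizLi2019.InN curve1323m1 (sqrtField (-47)) (r.d : ℤ) ∧ (0 : ℤ) < (r.d : ℤ) ∧ (r.d : ℤ) % 12 = 1 ∧ ¬ (7 : ℤ) ∣ (r.d : ℤ) := by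
  obtain ⟨hd0, hd12, hd4, hsq, hP⟩ := klExplicit_of_check h hD hc hb (by simp)
  obtain ⟨-, hdK⟩ := isImaginaryQuadratic_and_discr_sqrtField_neg_fortySeven
  refine ⟨inN_curve1323m1_of_explicit (sqrtField.finrank_eq_two (-47)) hd4 hsq fun ℓ hℓ hℓd => ?_, hd0, hd12,
    fun h7 => (hP 7 (by norm_num) (Int.natCast_dvd.mp (by exact_mod_cast h7))).1 (by simp)⟩
  obtain ⟨hbad, -, hj, hev⟩ := hP ℓ hℓ hℓd
  refine ⟨fun e => hbad (by simp [e]), fun e => hbad (by simp [e]), fun e => hbad (by simp [e]),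
      by rw [hdK]; exact hj, ?_⟩
  have e : ((112 : ℤ) : ZMod ℓ) = -(16 * (4 * (-2 : ZMod ℓ) + 1)) := by push_cast; norm_num
  rw [← e]; exact hev

/-- A certified `4563a1` record (base data `(-23, -5940688, [2, 3, 13])`) decoded: `d ∈ 𝒩(4563a1, ℚ(√-23))`,
`0 < d`, `d ≡ 1 (mod 12)`, `13 ∤ d`. [cite: KrizLi2019, Def. 4.1 (FMS) = arXiv Def. 3.1] -/
theorem inN_curve4563a1_of_check {r : KLRecord} (h : r.check = true) (hD : r.fieldDisc = -23)
    (hc : r.cubeConst = -5940688) (hb : r.badPrimes = [2, 3, 13]) :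
    KrizLi2019.InN curve4563a1 (sqrtField (-23)) (r.d : ℤ) ∧ (0 : ℤ) < (r.d : ℤ) ∧ (r.d : ℤ) % 12 = 1 ∧ ¬ (13 : ℤ) ∣ (r.d : ℤ) := by
  obtain ⟨hd0, hd12, hd4, hsq, hP⟩ := klExplicit_of_check h hD hc hb (by simp)
  obtain ⟨-, hdK⟩ := isImaginaryQuadratic_and_discr_sqrtField_neg_twentyThree
  refine ⟨inN_curve4563a1_of_explicit (sqrtField.finrank_eq_two (-23)) hd4 hsq fun ℓ hℓ hℓd => ?_, hd0, hd12,
    fun h13 => (hP 13 (by norm_num) (Int.natCast_dvd.mp (by exact_mod_cast h13))).1 (by simp)⟩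
  obtain ⟨hbad, -, hj, hev⟩ := hP ℓ hℓ hℓd
  refine ⟨fun e => hbad (by simp [e]), fun e => hbad (by simp [e]), fun e => hbad (by simp [e]),
      by rw [hdK]; exact hj, ?_⟩
  have e : ((-5940688 : ℤ) : ZMod ℓ) = -(16 * (4 * (92823 : ZMod ℓ) + 1)) := by push_cast; norm_num
  rw [← e]; exact hev

/-- A certified `972d1` record (base data `(-23, -36, [2, 3])`) decoded: `d ∈ 𝒩(972d1, ℚ(√-23))`,
`0 < d`, `d ≡ 1 (mod 12)`. [cite: KrizLi2019, Def. 4.1 (FMS) = arXiv Def. 3.1] -/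
theorem inN_curve972d1_of_check {r : KLRecord} (h : r.check = true) (hD : r.fieldDisc = -23)
    (hc : r.cubeConst = -36) (hb : r.badPrimes = [2, 3]) :
    KrizLi2019.InN curve972d1 (sqrtField (-23)) (r.d : ℤ) ∧ (0 : ℤ) < (r.d : ℤ) ∧ (r.d : ℤ) % 12 = 1 := by
  obtain ⟨hd0, hd12, hd4, hsq, hP⟩ := klExplicit_of_check h hD hc hb (by simp)
  obtain ⟨-, hdK⟩ := isImaginaryQuadratic_and_discr_sqrtField_neg_twentyThree
  refine ⟨inN_curve972d1_of_explicit (sqrtField.finrank_eq_two (-23)) hd4 hsq fun ℓ hℓ hℓd => ?_, hd0, hd12⟩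
  obtain ⟨hbad, -, hj, hev⟩ := hP ℓ hℓ hℓd
  refine ⟨fun e => hbad (by simp [e]), fun e => hbad (by simp [e]), by rw [hdK]; exact hj, ?_⟩
  have e : ((-36 : ℤ) : ZMod ℓ) = -36 := by push_cast; norm_num
  rw [← e]; exact hev

/-- A certified `3888s1` record (base data `(-23, -48, [2, 3])`) decoded: `d ∈ 𝒩(3888s1, ℚ(√-23))`,
`0 < d`, `d ≡ 1 (mod 12)`. [cite: KrizLi2019, Def. 4.1 (FMS) = arXiv Def. 3.1] -/
theorem inN_curve3888s1_of_check {r : KLRecord} (h : r.check = true) (hD : r.fieldDisc = -23)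
    (hc : r.cubeConst = -48) (hb : r.badPrimes = [2, 3]) :
    KrizLi2019.InN curve3888s1 (sqrtField (-23)) (r.d : ℤ) ∧ (0 : ℤ) < (r.d : ℤ) ∧ (r.d : ℤ) % 12 = 1 := by
  obtain ⟨hd0, hd12, hd4, hsq, hP⟩ := klExplicit_of_check h hD hc hb (by simp)
  obtain ⟨-, hdK⟩ := isImaginaryQuadratic_and_discr_sqrtField_neg_twentyThree
  refine ⟨inN_curve3888s1_of_explicit (sqrtField.finrank_eq_two (-23)) hd4 hsq fun ℓ hℓ hℓd => ?_, hd0, hd12⟩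
  obtain ⟨hbad, -, hj, hev⟩ := hP ℓ hℓ hℓd
  refine ⟨fun e => hbad (by simp [e]), fun e => hbad (by simp [e]), by rw [hdK]; exact hj, ?_⟩
  have e : ((-48 : ℤ) : ZMod ℓ) = -48 := by push_cast; norm_num
  rw [← e]; exact hev

/-- A certified `1728a1` record (base data `(-23, -2, [2, 3])`) decoded: `d ∈ 𝒩(1728a1, ℚ(√-23))`,
`0 < d`, `d ≡ 1 (mod 12)`. [cite: KrizLi2019, Def. 4.1 (FMS) = arXiv Def. 3.1] -/
theorem inN_curve1728a1_of_check {r : KLRecord} (h : r.check = true) (hD : r.fieldDisc = -23)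
    (hc : r.cubeConst = -2) (hb : r.badPrimes = [2, 3]) :
    KrizLi2019.InN curve1728a1 (sqrtField (-23)) (r.d : ℤ) ∧ (0 : ℤ) < (r.d : ℤ) ∧ (r.d : ℤ) % 12 = 1 := by
  obtain ⟨hd0, hd12, hd4, hsq, hP⟩ := klExplicit_of_check h hD hc hb (by simp)
  obtain ⟨-, hdK⟩ := isImaginaryQuadratic_and_discr_sqrtField_neg_twentyThree
  refine ⟨inN_curve1728a1_of_explicit (sqrtField.finrank_eq_two (-23)) hd4 hsq fun ℓ hℓ hℓd => ?_, hd0, hd12⟩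
  obtain ⟨hbad, -, hj, hev⟩ := hP ℓ hℓ hℓd
  refine ⟨fun e => hbad (by simp [e]), fun e => hbad (by simp [e]), by rw [hdK]; exact hj, ?_⟩
  have e : ((-2 : ℤ) : ZMod ℓ) = -2 := by push_cast; norm_num
  rw [← e]; exact hev

/-- A certified `1728v1` record (base data `(-23, 2, [2, 3])`) decoded: `d ∈ 𝒩(1728v1, ℚ(√-23))`,
`0 < d`, `d ≡ 1 (mod 12)`. [cite: KrizLi2019, Def. 4.1 (FMS) = arXiv Def. 3.1] -/
theorem inN_curve1728v1_of_check {r : KLRecord} (h : r.check = true) (hD : r.fieldDisc = -23)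
    (hc : r.cubeConst = 2) (hb : r.badPrimes = [2, 3]) :
    KrizLi2019.InN curve1728v1 (sqrtField (-23)) (r.d : ℤ) ∧ (0 : ℤ) < (r.d : ℤ) ∧ (r.d : ℤ) % 12 = 1 := by
  obtain ⟨hd0, hd12, hd4, hsq, hP⟩ := klExplicit_of_check h hD hc hb (by simp)
  obtain ⟨-, hdK⟩ := isImaginaryQuadratic_and_discr_sqrtField_neg_twentyThree
  refine ⟨inN_curve1728v1_of_explicit (sqrtField.finrank_eq_two (-23)) hd4 hsq fun ℓ hℓ hℓd => ?_, hd0, hd12⟩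
  obtain ⟨hbad, -, hj, hev⟩ := hP ℓ hℓ hℓd
  refine ⟨fun e => hbad (by simp [e]), fun e => hbad (by simp [e]), by rw [hdK]; exact hj, ?_⟩
  have e : ((2 : ℤ) : ZMod ℓ) = 2 := by push_cast; norm_num
  rw [← e]; exact hev

/-! ## §3 Record by record, BY NAME: the listed curve is globally minimal with `ord_{s=1} L = 1 ∧ BSD(·, 2)` -/

/-- **The Kriz–Li family at `(1323a1, ℚ(√-47))`, each of the 14 certified records ON THE NOSE**: the listed
model `E_k = [0,0,1,0,k] : y² + y = x³ + k` (`4k + 1 = 2401·d³`, §1) is globally minimal with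
`ord_{s=1} L(E_k, s) = 1 ∧ BSD(E_k, 2)`, granted the seven facts and the displayed (★)-certificate `hSD`.
[cite: KrizLi2019, Thm. 5.1 (2), Thm. 4.3, Def. 4.1 and §6 Ex. 6.2] [cite: CreutzMiller2012, Thm. 1.1]
[cite: BurungaleFlach2024, Thm. 1.1 and Cor. 2] [cite: MilneADT2006, Thm. I.7.3] [cite: SilvermanAEC2009, VII.1 Remark 1.1] [cite: Miller2011LMS, Def. 1.1] -/
theorem analyticRank_eq_one_and_bsdp_two_twistModel_of_mem_recordsKrizLiThirteenTwentyThreeA (hKL : KrizLi2019.thm112_bsdTwo_twist)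
    (h33 : KrizLi2019.thm33_rank_twist) (hS31 : bsdTriple_of_analyticRank_le_one_of_conductor_lt)
    (hBF : bsdTriple_of_hasCM_of_L_one_ne_zero) (hmod : hasEntireLFunction_rat)
    (hGZK : rank_eq_analyticRank_of_analyticRank_le_one) (hCassels : bsdRHS_eq_of_isIsogenous)
    (hSD : HasKrizLiStarDatum curve1323a1 (sqrtField (-47))) :
    ∀ r ∈ recordsKrizLiThirteenTwentyThreeA, ∀ k : ℤ, r.ainvs = [0, 0, 1, 0, k] →
      ∃ _ : (cubicA₃ k).IsGloballyMinimal, (cubicA₃ k).analyticRank = 1 ∧ BSDp (cubicA₃ k) 2 := by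
  intro r hr k hk
  obtain ⟨-, hm⟩ := twistModel_of_mem_recordsKrizLiThirteenTwentyThreeA r hr
  rw [hk, show ([0, 0, 1, 0, k] : List ℤ).getLastD 0 = k from rfl] at hm
  obtain ⟨hIn, hd0, hd12, hqd⟩ := inN_curve1323a1_of_check (certified_recordsKrizLiThirteenTwentyThreeA.check_of_mem hr)
    ((params_and_base_of_recordsKrizLiThirteenTwentyThreeA).2 r hr).1 ((params_and_base_of_recordsKrizLiThirteenTwentyThreeA).2 r hr).2.1
    ((params_and_base_of_recordsKrizLiThirteenTwentyThreeA).2 r hr).2.2.1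
  obtain ⟨hK, hdK⟩ := isImaginaryQuadratic_and_discr_sqrtField_neg_fortySeven
  exact analyticRank_eq_one_and_bsdp_two_twistModel_curve1323a1 hKL h33 hS31 hBF hmod hGZK hCassels hK
    (by rw [hdK]; norm_num) (by rw [hdK]; norm_num) hSD hm hIn hd0 hd12 hqd

/-- **The Kriz–Li family at `(1323m1, ℚ(√-47))`, each of the 14 certified records ON THE NOSE**: the listed
model `E_k = [0,0,1,0,k] : y² + y = x³ + k` (`4k + 1 = -7·d³`, §1) is globally minimal with
`ord_{s=1} L(E_k, s) = 1 ∧ BSD(E_k, 2)`, granted the seven facts and the displayed (★)-certificate `hSD`.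
[cite: KrizLi2019, Thm. 5.1 (2), Thm. 4.3, Def. 4.1 and §6 Ex. 6.2] [cite: CreutzMiller2012, Thm. 1.1]
[cite: BurungaleFlach2024, Thm. 1.1 and Cor. 2] [cite: MilneADT2006, Thm. I.7.3] [cite: SilvermanAEC2009, VII.1 Remark 1.1] [cite: Miller2011LMS, Def. 1.1] -/
theorem analyticRank_eq_one_and_bsdp_two_twistModel_of_mem_recordsKrizLiThirteenTwentyThreeM (hKL : KrizLi2019.thm112_bsdTwo_twist)
    (h33 : KrizLi2019.thm33_rank_twist) (hS31 : bsdTriple_of_analyticRank_le_one_of_conductor_lt)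
    (hBF : bsdTriple_of_hasCM_of_L_one_ne_zero) (hmod : hasEntireLFunction_rat)
    (hGZK : rank_eq_analyticRank_of_analyticRank_le_one) (hCassels : bsdRHS_eq_of_isIsogenous)
    (hSD : HasKrizLiStarDatum curve1323m1 (sqrtField (-47))) :
    ∀ r ∈ recordsKrizLiThirteenTwentyThreeM, ∀ k : ℤ, r.ainvs = [0, 0, 1, 0, k] →
      ∃ _ : (cubicA₃ k).IsGloballyMinimal, (cubicA₃ k).analyticRank = 1 ∧ BSDp (cubicA₃ k) 2 := by
  intro r hr k hk
  obtain ⟨-, hm⟩ := twistModel_of_mem_recordsKrizLiThirteenTwentyThreeM r hr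
  rw [hk, show ([0, 0, 1, 0, k] : List ℤ).getLastD 0 = k from rfl] at hm
  obtain ⟨hIn, hd0, hd12, hqd⟩ := inN_curve1323m1_of_check (certified_recordsKrizLiThirteenTwentyThreeM.check_of_mem hr)
    ((params_and_base_of_recordsKrizLiThirteenTwentyThreeM).2 r hr).1 ((params_and_base_of_recordsKrizLiThirteenTwentyThreeM).2 r hr).2.1
    ((params_and_base_of_recordsKrizLiThirteenTwentyThreeM).2 r hr).2.2.1
  obtain ⟨hK, hdK⟩ := isImaginaryQuadratic_and_discr_sqrtField_neg_fortySeven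
  exact analyticRank_eq_one_and_bsdp_two_twistModel_curve1323m1 hKL h33 hS31 hBF hmod hGZK hCassels hK
    (by rw [hdK]; norm_num) (by rw [hdK]; norm_num) hSD hm hIn hd0 hd12 hqd

/-- **The Kriz–Li family at `(4563a1, ℚ(√-23))`, each of the 4 certified records ON THE NOSE**: the listed
model `E_k = [0,0,1,0,k] : y² + y = x³ + k` (`4k + 1 = 371293·d³`, §1) is globally minimal with
`ord_{s=1} L(E_k, s) = 1 ∧ BSD(E_k, 2)`, granted the seven facts and the displayed (★)-certificate `hSD`.
[cite: KrizLi2019, Thm. 5.1 (2), Thm. 4.3, Def. 4.1 and §6 Ex. 6.2] [cite: CreutzMiller2012, Thm. 1.1]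
[cite: BurungaleFlach2024, Thm. 1.1 and Cor. 2] [cite: MilneADT2006, Thm. I.7.3] [cite: SilvermanAEC2009, VII.1 Remark 1.1] [cite: Miller2011LMS, Def. 1.1] -/
theorem analyticRank_eq_one_and_bsdp_two_twistModel_of_mem_recordsKrizLiFortyFiveSixtyThreeA (hKL : KrizLi2019.thm112_bsdTwo_twist)
    (h33 : KrizLi2019.thm33_rank_twist) (hS31 : bsdTriple_of_analyticRank_le_one_of_conductor_lt)
    (hBF : bsdTriple_of_hasCM_of_L_one_ne_zero) (hmod : hasEntireLFunction_rat)
    (hGZK : rank_eq_analyticRank_of_analyticRank_le_one) (hCassels : bsdRHS_eq_of_isIsogenous)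
    (hSD : HasKrizLiStarDatum curve4563a1 (sqrtField (-23))) :
    ∀ r ∈ recordsKrizLiFortyFiveSixtyThreeA, ∀ k : ℤ, r.ainvs = [0, 0, 1, 0, k] →
      ∃ _ : (cubicA₃ k).IsGloballyMinimal, (cubicA₃ k).analyticRank = 1 ∧ BSDp (cubicA₃ k) 2 := by
  intro r hr k hk
  obtain ⟨-, hm⟩ := twistModel_of_mem_recordsKrizLiFortyFiveSixtyThreeA r hr
  rw [hk, show ([0, 0, 1, 0, k] : List ℤ).getLastD 0 = k from rfl] at hm
  obtain ⟨hIn, hd0, hd12, hqd⟩ := inN_curve4563a1_of_check (certified_recordsKrizLiFortyFiveSixtyThreeA.check_of_mem hr)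
    ((params_and_base_of_recordsKrizLiFortyFiveSixtyThreeA).2 r hr).1 ((params_and_base_of_recordsKrizLiFortyFiveSixtyThreeA).2 r hr).2.1
    ((params_and_base_of_recordsKrizLiFortyFiveSixtyThreeA).2 r hr).2.2.1
  obtain ⟨hK, hdK⟩ := isImaginaryQuadratic_and_discr_sqrtField_neg_twentyThree
  exact analyticRank_eq_one_and_bsdp_two_twistModel_curve4563a1 hKL h33 hS31 hBF hmod hGZK hCassels hK
    (by rw [hdK]; norm_num) (by rw [hdK]; norm_num) hSD hm hIn hd0 hd12 hqd

/-- **The Kriz–Li family at `(972d1, ℚ(√-23))`, each of the 10 certified records ON THE NOSE**: the listed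
model `[0,0,0,0,a₆] : y² = x³ + a₆` (`a₆ = 36·d³`, §1) is a globally minimal elliptic curve with
`ord_{s=1} L = 1 ∧ BSD(·, 2)`, granted the seven facts and the displayed (★)-certificate `hSD` (the Manin clause of
Thm 5.1 (2), live at this additive base, is inside `hSD`).
[cite: KrizLi2019, Thm. 5.1 (2), Thm. 4.3, Def. 4.1 and §6 Ex. 6.2] [cite: CreutzMiller2012, Thm. 1.1]
[cite: BurungaleFlach2024, Thm. 1.1 and Cor. 2] [cite: MilneADT2006, Thm. I.7.3] [cite: SilvermanAEC2009, VII.1 Remark 1.1] [cite: Miller2011LMS, Def. 1.1] -/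
theorem analyticRank_eq_one_and_bsdp_two_twistModel_of_mem_recordsKrizLiNineSeventyTwoD (hKL : KrizLi2019.thm112_bsdTwo_twist)
    (h33 : KrizLi2019.thm33_rank_twist) (hS31 : bsdTriple_of_analyticRank_le_one_of_conductor_lt)
    (hBF : bsdTriple_of_hasCM_of_L_one_ne_zero) (hmod : hasEntireLFunction_rat)
    (hGZK : rank_eq_analyticRank_of_analyticRank_le_one) (hCassels : bsdRHS_eq_of_isIsogenous)
    (hSD : HasKrizLiStarDatum curve972d1 (sqrtField (-23))) :
    ∀ r ∈ recordsKrizLiNineSeventyTwoD, ∀ a6 : ℤ, r.ainvs = [0, 0, 0, 0, a6] →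
      ∃ (_ : (⟨0, 0, 0, 0, (a6 : ℚ)⟩ : WeierstrassCurve ℚ).IsElliptic)
        (_ : (⟨0, 0, 0, 0, (a6 : ℚ)⟩ : WeierstrassCurve ℚ).IsGloballyMinimal),
        (⟨0, 0, 0, 0, (a6 : ℚ)⟩ : WeierstrassCurve ℚ).analyticRank = 1 ∧
          BSDp (⟨0, 0, 0, 0, (a6 : ℚ)⟩ : WeierstrassCurve ℚ) 2 := by
  intro r hr a6 ha
  obtain ⟨-, hm⟩ := twistModel_of_mem_recordsKrizLiNineSeventyTwoD r hr
  rw [ha, show ([0, 0, 0, 0, a6] : List ℤ).getLastD 0 = a6 from rfl] at hm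
  obtain ⟨hIn, hd0, hd12⟩ := inN_curve972d1_of_check (certified_recordsKrizLiNineSeventyTwoD.check_of_mem hr)
    ((params_and_base_of_recordsKrizLiNineSeventyTwoD).2 r hr).1 ((params_and_base_of_recordsKrizLiNineSeventyTwoD).2 r hr).2.1
    ((params_and_base_of_recordsKrizLiNineSeventyTwoD).2 r hr).2.2.1
  obtain ⟨hK, hdK⟩ := isImaginaryQuadratic_and_discr_sqrtField_neg_twentyThree
  exact analyticRank_eq_one_and_bsdp_two_twistModel_curve972d1 hKL h33 hS31 hBF hmod hGZK hCassels hK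
    (by rw [hdK]; norm_num) (by rw [hdK]; norm_num) hSD hm hIn hd0 hd12

/-- **The Kriz–Li family at `(3888s1, ℚ(√-23))`, each of the 7 certified records ON THE NOSE**: the listed
model `[0,0,0,0,a₆] : y² = x³ + a₆` (`a₆ = 48·d³`, §1) is a globally minimal elliptic curve with
`ord_{s=1} L = 1 ∧ BSD(·, 2)`, granted the seven facts and the displayed (★)-certificate `hSD` (the Manin clause of
Thm 5.1 (2), live at this additive base, is inside `hSD`).
[cite: KrizLi2019, Thm. 5.1 (2), Thm. 4.3, Def. 4.1 and §6 Ex. 6.2] [cite: CreutzMiller2012, Thm. 1.1]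
[cite: BurungaleFlach2024, Thm. 1.1 and Cor. 2] [cite: MilneADT2006, Thm. I.7.3] [cite: SilvermanAEC2009, VII.1 Remark 1.1] [cite: Miller2011LMS, Def. 1.1] -/
theorem analyticRank_eq_one_and_bsdp_two_twistModel_of_mem_recordsKrizLiThirtyEightEightyEightS (hKL : KrizLi2019.thm112_bsdTwo_twist)
    (h33 : KrizLi2019.thm33_rank_twist) (hS31 : bsdTriple_of_analyticRank_le_one_of_conductor_lt)
    (hBF : bsdTriple_of_hasCM_of_L_one_ne_zero) (hmod : hasEntireLFunction_rat)
    (hGZK : rank_eq_analyticRank_of_analyticRank_le_one) (hCassels : bsdRHS_eq_of_isIsogenous)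
    (hSD : HasKrizLiStarDatum curve3888s1 (sqrtField (-23))) :
    ∀ r ∈ recordsKrizLiThirtyEightEightyEightS, ∀ a6 : ℤ, r.ainvs = [0, 0, 0, 0, a6] →
      ∃ (_ : (⟨0, 0, 0, 0, (a6 : ℚ)⟩ : WeierstrassCurve ℚ).IsElliptic)
        (_ : (⟨0, 0, 0, 0, (a6 : ℚ)⟩ : WeierstrassCurve ℚ).IsGloballyMinimal),
        (⟨0, 0, 0, 0, (a6 : ℚ)⟩ : WeierstrassCurve ℚ).analyticRank = 1 ∧
          BSDp (⟨0, 0, 0, 0, (a6 : ℚ)⟩ : WeierstrassCurve ℚ) 2 := by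
  intro r hr a6 ha
  obtain ⟨-, hm⟩ := twistModel_of_mem_recordsKrizLiThirtyEightEightyEightS r hr
  rw [ha, show ([0, 0, 0, 0, a6] : List ℤ).getLastD 0 = a6 from rfl] at hm
  obtain ⟨hIn, hd0, hd12⟩ := inN_curve3888s1_of_check (certified_recordsKrizLiThirtyEightEightyEightS.check_of_mem hr)
    ((params_and_base_of_recordsKrizLiThirtyEightEightyEightS).2 r hr).1 ((params_and_base_of_recordsKrizLiThirtyEightEightyEightS).2 r hr).2.1
    ((params_and_base_of_recordsKrizLiThirtyEightEightyEightS).2 r hr).2.2.1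
  obtain ⟨hK, hdK⟩ := isImaginaryQuadratic_and_discr_sqrtField_neg_twentyThree
  exact analyticRank_eq_one_and_bsdp_two_twistModel_curve3888s1 hKL h33 hS31 hBF hmod hGZK hCassels hK
    (by rw [hdK]; norm_num) (by rw [hdK]; norm_num) hSD hm hIn hd0 hd12

/-- **The Kriz–Li family at `(1728a1, ℚ(√-23))`, each of the 8 certified records ON THE NOSE**: the listed
model `[0,0,0,0,a₆] : y² = x³ + a₆` (`a₆ = 2·d³`, §1) is a globally minimal elliptic curve with
`ord_{s=1} L = 1 ∧ BSD(·, 2)`, granted the seven facts and the displayed (★)-certificate `hSD` (the Manin clause of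
Thm 5.1 (2), live at this additive base, is inside `hSD`).
[cite: KrizLi2019, Thm. 5.1 (2), Thm. 4.3, Def. 4.1 and §6 Ex. 6.2] [cite: CreutzMiller2012, Thm. 1.1]
[cite: BurungaleFlach2024, Thm. 1.1 and Cor. 2] [cite: MilneADT2006, Thm. I.7.3] [cite: SilvermanAEC2009, VII.1 Remark 1.1] [cite: Miller2011LMS, Def. 1.1] -/
theorem analyticRank_eq_one_and_bsdp_two_twistModel_of_mem_recordsKrizLiSeventeenTwentyEightA (hKL : KrizLi2019.thm112_bsdTwo_twist)
    (h33 : KrizLi2019.thm33_rank_twist) (hS31 : bsdTriple_of_analyticRank_le_one_of_conductor_lt)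
    (hBF : bsdTriple_of_hasCM_of_L_one_ne_zero) (hmod : hasEntireLFunction_rat)
    (hGZK : rank_eq_analyticRank_of_analyticRank_le_one) (hCassels : bsdRHS_eq_of_isIsogenous)
    (hSD : HasKrizLiStarDatum curve1728a1 (sqrtField (-23))) :
    ∀ r ∈ recordsKrizLiSeventeenTwentyEightA, ∀ a6 : ℤ, r.ainvs = [0, 0, 0, 0, a6] →
      ∃ (_ : (⟨0, 0, 0, 0, (a6 : ℚ)⟩ : WeierstrassCurve ℚ).IsElliptic)
        (_ : (⟨0, 0, 0, 0, (a6 : ℚ)⟩ : WeierstrassCurve ℚ).IsGloballyMinimal),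
        (⟨0, 0, 0, 0, (a6 : ℚ)⟩ : WeierstrassCurve ℚ).analyticRank = 1 ∧
          BSDp (⟨0, 0, 0, 0, (a6 : ℚ)⟩ : WeierstrassCurve ℚ) 2 := by
  intro r hr a6 ha
  obtain ⟨-, hm⟩ := twistModel_of_mem_recordsKrizLiSeventeenTwentyEightA r hr
  rw [ha, show ([0, 0, 0, 0, a6] : List ℤ).getLastD 0 = a6 from rfl] at hm
  obtain ⟨hIn, hd0, hd12⟩ := inN_curve1728a1_of_check (certified_recordsKrizLiSeventeenTwentyEightA.check_of_mem hr)
    ((params_and_base_of_recordsKrizLiSeventeenTwentyEightA).2 r hr).1 ((params_and_base_of_recordsKrizLiSeventeenTwentyEightA).2 r hr).2.1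
    ((params_and_base_of_recordsKrizLiSeventeenTwentyEightA).2 r hr).2.2.1
  obtain ⟨hK, hdK⟩ := isImaginaryQuadratic_and_discr_sqrtField_neg_twentyThree
  exact analyticRank_eq_one_and_bsdp_two_twistModel_curve1728a1 hKL h33 hS31 hBF hmod hGZK hCassels hK
    (by rw [hdK]; norm_num) (by rw [hdK]; norm_num) hSD hm hIn hd0 hd12

/-- **The Kriz–Li family at `(1728v1, ℚ(√-23))`, each of the 7 certified records ON THE NOSE**: the listed
model `[0,0,0,0,a₆] : y² = x³ + a₆` (`a₆ = -2·d³`, §1) is a globally minimal elliptic curve with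
`ord_{s=1} L = 1 ∧ BSD(·, 2)`, granted the seven facts and the displayed (★)-certificate `hSD` (the Manin clause of
Thm 5.1 (2), live at this additive base, is inside `hSD`).
[cite: KrizLi2019, Thm. 5.1 (2), Thm. 4.3, Def. 4.1 and §6 Ex. 6.2] [cite: CreutzMiller2012, Thm. 1.1]
[cite: BurungaleFlach2024, Thm. 1.1 and Cor. 2] [cite: MilneADT2006, Thm. I.7.3] [cite: SilvermanAEC2009, VII.1 Remark 1.1] [cite: Miller2011LMS, Def. 1.1] -/
theorem analyticRank_eq_one_and_bsdp_two_twistModel_of_mem_recordsKrizLiSeventeenTwentyEightV (hKL : KrizLi2019.thm112_bsdTwo_twist)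
    (h33 : KrizLi2019.thm33_rank_twist) (hS31 : bsdTriple_of_analyticRank_le_one_of_conductor_lt)
    (hBF : bsdTriple_of_hasCM_of_L_one_ne_zero) (hmod : hasEntireLFunction_rat)
    (hGZK : rank_eq_analyticRank_of_analyticRank_le_one) (hCassels : bsdRHS_eq_of_isIsogenous)
    (hSD : HasKrizLiStarDatum curve1728v1 (sqrtField (-23))) :
    ∀ r ∈ recordsKrizLiSeventeenTwentyEightV, ∀ a6 : ℤ, r.ainvs = [0, 0, 0, 0, a6] →
      ∃ (_ : (⟨0, 0, 0, 0, (a6 : ℚ)⟩ : WeierstrassCurve ℚ).IsElliptic)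
        (_ : (⟨0, 0, 0, 0, (a6 : ℚ)⟩ : WeierstrassCurve ℚ).IsGloballyMinimal),
        (⟨0, 0, 0, 0, (a6 : ℚ)⟩ : WeierstrassCurve ℚ).analyticRank = 1 ∧
          BSDp (⟨0, 0, 0, 0, (a6 : ℚ)⟩ : WeierstrassCurve ℚ) 2 := by
  intro r hr a6 ha
  obtain ⟨-, hm⟩ := twistModel_of_mem_recordsKrizLiSeventeenTwentyEightV r hr
  rw [ha, show ([0, 0, 0, 0, a6] : List ℤ).getLastD 0 = a6 from rfl] at hm
  obtain ⟨hIn, hd0, hd12⟩ := inN_curve1728v1_of_check (certified_recordsKrizLiSeventeenTwentyEightV.check_of_mem hr)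
    ((params_and_base_of_recordsKrizLiSeventeenTwentyEightV).2 r hr).1 ((params_and_base_of_recordsKrizLiSeventeenTwentyEightV).2 r hr).2.1
    ((params_and_base_of_recordsKrizLiSeventeenTwentyEightV).2 r hr).2.2.1
  obtain ⟨hK, hdK⟩ := isImaginaryQuadratic_and_discr_sqrtField_neg_twentyThree
  exact analyticRank_eq_one_and_bsdp_two_twistModel_curve1728v1 hKL h33 hS31 hBF hmod hGZK hCassels hK
    (by rw [hdK]; norm_num) (by rw [hdK]; norm_num) hSD hm hIn hd0 hd12

end Summit.BirchSwinnertonDyer.Rank1Residual.P2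

end
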